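import Summits.Ventures.Crystal3D.Theorems.StickyWulffConstantCoaxialWallLawDoubleVacancy
import Summits.Ventures.Crystal3D.Theorems.StickyWulffConstantCoaxialWallLawFrame
import HarnessLib

/-!
# Two foreign contacts block at least three slots (double-vacancy lemma, lattice form)

HONEST FRAMING. Part of the venture `Summits/Ventures/Crystal3D` (cell `crystal3d-full`), helper
`--supports` the crux `CoaxialWallLaw` (stmt-Ventures-19481, `route-Ventures-StickyWulffConstant`),
REGISTERED line `WallLedgerF` (planner cf-p1 gen 16), stub `stub_coaxialTwoSlabAdhesion`
(riser ledger, absorption inequality for two foreign partners); usable by `WallLedgerG`.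
Transports the cubic-frame lemma `cubicShell_double_vacancy` (`…CoaxialWallLawDoubleVacancy`) to
the model lattice and to moved lattices, exactly as `fcc_single_vacancy(_moved)` transported
`cubicShell_single_vacancy`.

* `fcc_double_vacancy` — `q ∈ Λ₀` with two nearest-neighbour sites `z₁ ≠ z₂`; if two points
  `y, y'` at distance `1` from `q` and at distance `≥ 1` from each other keep distance `≥ 1` from
  every nearest-neighbour site of `q` other than `z₁, z₂`, then `{y, y'} = {z₁, z₂}`;
* `fcc_double_vacancy_moved` — the same for `A·Λ₀ + t`;
* `fcc_foreign_blocks_two` / `fcc_two_foreign_block_three` — ledger corollaries: ONE foreign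
  contact (`y ∉ A·Λ₀ + t`) of a lattice ball lies within distance `< 1` of at least TWO of its slot
  sites; TWO mutually non-overlapping contacts, one of them foreign, lie within distance `< 1` of at
  least THREE slot sites between them (so the blocked-slot weight is `≥ 1`, resp. `≥ 3/2`; the ribbon lemma
  and height quantisation upgrade the latter to `≥ 2` — separate work).

WHAT THIS IS NOT: three foreign contacts; the stub; rung F-C1 not moved.
-/

noncomputable section

namespace Summit.Ventures.Crystal3D.Theorems

open Summit.Ventures.Crystal3D Finset
open Literature.MathematicalPhysics.StatisticalMechanics (barlowPos barlowStacking fccStacking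
  constHagg haggLabel_const barlowPos_mem)

/-- **Double-vacancy lemma (`Λ₀` form).**  `q, z₁, z₂ ∈ Λ₀`, `z₁ ≠ z₂` nearest neighbours of `q`;
`y, y'` touch `q`, `dist y y' ≥ 1`, and both keep distance `≥ 1` from every nearest-neighbour
site of `q` other than `z₁, z₂`.  Then `(y, y') = (z₁, z₂)` or `(z₂, z₁)`. -/
theorem fcc_double_vacancy (q y y' z₁ z₂ : EuclideanSpace ℝ (Fin 3))
    (hq : q ∈ fccStacking 1 (Real.sqrt (2 / 3))) (hz₁ : z₁ ∈ fccStacking 1 (Real.sqrt (2 / 3)))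
    (hz₂ : z₂ ∈ fccStacking 1 (Real.sqrt (2 / 3))) (hqz₁ : dist q z₁ = 1) (hqz₂ : dist q z₂ = 1)
    (hne : z₁ ≠ z₂) (hy : dist q y = 1) (hy' : dist q y' = 1) (hyy' : 1 ≤ dist y y')
    (h : ∀ z ∈ fccStacking 1 (Real.sqrt (2 / 3)), dist q z = 1 → z ≠ z₁ → z ≠ z₂ →
      1 ≤ dist y z ∧ 1 ≤ dist y' z) :
    (y = z₁ ∧ y' = z₂) ∨ (y = z₂ ∧ y' = z₁) := by
  obtain ⟨k₀, i₀, j₀, rfl⟩ := hq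
  set q := barlowPos 1 (Real.sqrt (2 / 3)) constHagg k₀ i₀ j₀ with hqdef
  -- cubic coordinates of a point relative to `q`
  let A : EuclideanSpace ℝ (Fin 3) → ℝ := fun p =>
    (p - q) 0 + Real.sqrt 3 / 3 * (p - q) 1 - Real.sqrt (2 / 3) * (p - q) 2
  let B : EuclideanSpace ℝ (Fin 3) → ℝ := fun p =>
    (p - q) 0 - Real.sqrt 3 / 3 * (p - q) 1 + Real.sqrt (2 / 3) * (p - q) 2
  let C : EuclideanSpace ℝ (Fin 3) → ℝ := fun p =>
    2 * Real.sqrt 3 / 3 * (p - q) 1 + Real.sqrt (2 / 3) * (p - q) 2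
  have hAp : ∀ p, A p = (p - q) 0 + Real.sqrt 3 / 3 * (p - q) 1 - Real.sqrt (2 / 3) * (p - q) 2 :=
    fun p => rfl
  have hBp : ∀ p, B p = (p - q) 0 - Real.sqrt 3 / 3 * (p - q) 1 + Real.sqrt (2 / 3) * (p - q) 2 :=
    fun p => rfl
  have hCp : ∀ p, C p = 2 * Real.sqrt 3 / 3 * (p - q) 1 + Real.sqrt (2 / 3) * (p - q) 2 :=
    fun p => rfl
  -- `2·dist(p, p')² = (A p − A p')² + (B p − B p')² + (C p − C p')²`
  have hcub : ∀ p p' : EuclideanSpace ℝ (Fin 3),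
      2 * dist p p' ^ 2 = (A p - A p') ^ 2 + (B p - B p') ^ 2 + (C p - C p') ^ 2 := by
    intro p p'
    have h0 := two_mul_norm_sq_eq_cubic (p - p')
    have e : ∀ l, (p - p') l = (p - q) l - (p' - q) l := fun l => by
      simp only [PiLp.sub_apply]; ring
    rw [e 0, e 1, e 2] at h0
    rw [dist_eq_norm, h0, hAp, hAp, hBp, hBp, hCp, hCp]
    ring
  have hAq : A q = 0 ∧ B q = 0 ∧ C q = 0 := by
    rw [hAp, hBp, hCp]
    simp only [sub_self, PiLp.zero_apply]; norm_num
  have hnorm : ∀ p, dist q p = 1 → A p ^ 2 + B p ^ 2 + C p ^ 2 = 2 := by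
    intro p hp
    have h0 := hcub p q
    rw [dist_comm, hp, hAq.1, hAq.2.1, hAq.2.2] at h0
    linarith
  have h2 := hnorm y hy
  have h2' := hnorm y' hy'
  -- mutual inner product `≤ 1`
  have hin : A y * A y' + B y * B y' + C y * C y' ≤ 1 := by
    have h0 := hcub y y'
    have hd1 : 1 ≤ dist y y' ^ 2 := one_le_pow₀ hyy'
    have hexp : (A y - A y') ^ 2 + (B y - B y') ^ 2 + (C y - C y') ^ 2 =
        (A y ^ 2 + B y ^ 2 + C y ^ 2) + (A y' ^ 2 + B y' ^ 2 + C y' ^ 2) -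
          2 * (A y * A y' + B y * B y' + C y * C y') := by ring
    linarith [h0, hd1, h2, h2', hexp]
  -- cubic coordinates of `z₁, z₂`
  obtain ⟨v₁, hv₁, hv₁A, hv₁B, hv₁C⟩ := cubic_of_unit_neighbour z₁ hz₁ k₀ i₀ j₀ hqz₁
  obtain ⟨v₂, hv₂, hv₂A, hv₂B, hv₂C⟩ := cubic_of_unit_neighbour z₂ hz₂ k₀ i₀ j₀ hqz₂
  have hv₁' : A z₁ = v₁.1 ∧ B z₁ = v₁.2.1 ∧ C z₁ = v₁.2.2 := ⟨hv₁A, hv₁B, hv₁C⟩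
  have hv₂' : A z₂ = v₂.1 ∧ B z₂ = v₂.2.1 ∧ C z₂ = v₂.2.2 := ⟨hv₂A, hv₂B, hv₂C⟩
  have hvne : v₁ ≠ v₂ := by
    intro hvv
    apply hne
    apply eq_of_cubic_sub_eq z₁ z₂ q
    · show A z₁ = A z₂
      rw [hv₁'.1, hv₂'.1, hvv]
    · show B z₁ = B z₂
      rw [hv₁'.2.1, hv₂'.2.1, hvv]
    · show C z₁ = C z₂
      rw [hv₁'.2.2, hv₂'.2.2, hvv]
  -- the slot constraints for both points
  have hslots : ∀ p, dist q p = 1 → (∀ z ∈ fccStacking 1 (Real.sqrt (2 / 3)), dist q z = 1 →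
        z ≠ z₁ → z ≠ z₂ → 1 ≤ dist p z) →
      ∀ s ∈ ([((1 : ℤ), (1 : ℤ), (0 : ℤ)), (1, -1, 0), (-1, 1, 0), (-1, -1, 0), (1, 0, 1), (1, 0, -1),
        (-1, 0, 1), (-1, 0, -1), (0, 1, 1), (0, 1, -1), (0, -1, 1), (0, -1, -1)] : List (ℤ × ℤ × ℤ)),
        s ≠ v₁ → s ≠ v₂ → A p * (s.1 : ℝ) + B p * (s.2.1 : ℝ) + C p * (s.2.2 : ℝ) ≤ 1 := by
    intro p hp hpz s hs hs1 hs2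
    obtain ⟨hsmod, hsn0⟩ := cubicShell_facts s hs
    have hse : Even (s.1 + s.2.1 + s.2.2) := Int.even_iff.2 hsmod
    have hsn : (s.1 : ℝ) ^ 2 + (s.2.1 : ℝ) ^ 2 + (s.2.2 : ℝ) ^ 2 = 2 := by exact_mod_cast hsn0
    obtain ⟨z, hzΛ, hzA, hzB, hzC, hzd⟩ := exists_site_at_cubic_offset k₀ i₀ j₀ s hse
    have hz' : A z = s.1 ∧ B z = s.2.1 ∧ C z = s.2.2 := ⟨hzA, hzB, hzC⟩
    rw [hsn] at hzd
    have hqz : dist q z = 1 := by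
      have hsq1 : dist q z ^ 2 = 1 := by linarith
      exact (pow_eq_one_iff_of_nonneg dist_nonneg two_ne_zero).1 hsq1
    have hneq : ∀ (w : ℤ × ℤ × ℤ) (zw : EuclideanSpace ℝ (Fin 3)),
        A zw = w.1 ∧ B zw = w.2.1 ∧ C zw = w.2.2 → s ≠ w → z ≠ zw := by
      rintro w zw ⟨hwA, hwB, hwC⟩ hsw hzz
      apply hsw
      rw [hzz] at hz'
      have e1 : (s.1 : ℝ) = w.1 := by rw [← hz'.1, hwA]
      have e2 : (s.2.1 : ℝ) = w.2.1 := by rw [← hz'.2.1, hwB]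
      have e3 : (s.2.2 : ℝ) = w.2.2 := by rw [← hz'.2.2, hwC]
      have e1' : s.1 = w.1 := by exact_mod_cast e1
      have e2' : s.2.1 = w.2.1 := by exact_mod_cast e2
      have e3' : s.2.2 = w.2.2 := by exact_mod_cast e3
      exact Prod.ext e1' (Prod.ext e2' e3')
    have hpz1 := hpz z hzΛ hqz (hneq v₁ z₁ hv₁' hs1) (hneq v₂ z₂ hv₂' hs2)
    have h0 := hcub p z
    rw [hz'.1, hz'.2.1, hz'.2.2] at h0
    have hd1 : 1 ≤ dist p z ^ 2 := one_le_pow₀ hpz1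
    have hp2 := hnorm p hp
    have hexp : (A p - s.1) ^ 2 + (B p - s.2.1) ^ 2 + (C p - s.2.2) ^ 2 =
        (A p ^ 2 + B p ^ 2 + C p ^ 2) + ((s.1 : ℝ) ^ 2 + (s.2.1 : ℝ) ^ 2 + (s.2.2 : ℝ) ^ 2) -
          2 * (A p * (s.1 : ℝ) + B p * (s.2.1 : ℝ) + C p * (s.2.2 : ℝ)) := by ring
    linarith [h0, hd1, hp2, hsn, hexp]
  have hs := hslots y hy (fun z hz hqz h1 h2' => (h z hz hqz h1 h2').1)
  have hs' := hslots y' hy' (fun z hz hqz h1 h2' => (h z hz hqz h1 h2').2)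
  rcases cubicShell_double_vacancy (A y) (B y) (C y) (A y') (B y') (C y') h2 h2' v₁ v₂ hv₁ hv₂ hvne
    hs hs' hin with ⟨e1, e2, e3, e4, e5, e6⟩ | ⟨e1, e2, e3, e4, e5, e6⟩
  · left
    constructor
    · apply eq_of_cubic_sub_eq y z₁ q
      · show A y = A z₁
        rw [hv₁'.1, e1]
      · show B y = B z₁
        rw [hv₁'.2.1, e2]
      · show C y = C z₁
        rw [hv₁'.2.2, e3]
    · apply eq_of_cubic_sub_eq y' z₂ q
      · show A y' = A z₂
        rw [hv₂'.1, e4]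
      · show B y' = B z₂
        rw [hv₂'.2.1, e5]
      · show C y' = C z₂
        rw [hv₂'.2.2, e6]
  · right
    constructor
    · apply eq_of_cubic_sub_eq y z₂ q
      · show A y = A z₂
        rw [hv₂'.1, e1]
      · show B y = B z₂
        rw [hv₂'.2.1, e2]
      · show C y = C z₂
        rw [hv₂'.2.2, e3]
    · apply eq_of_cubic_sub_eq y' z₁ q
      · show A y' = A z₁
        rw [hv₁'.1, e4]
      · show B y' = B z₁
        rw [hv₁'.2.1, e5]
      · show C y' = C z₁
        rw [hv₁'.2.2, e6]

/-- **A foreign contact blocks at least two slots.**  `q ∈ A·Λ₀ + t`, `y ∉ A·Λ₀ + t` with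
`dist q y = 1`: there are two distinct nearest-neighbour sites `z₁ ≠ z₂` of `q` in `A·Λ₀ + t`
with `dist y zᵢ < 1` (so a ball at `y` forces both slots to be vacant). -/
theorem fcc_foreign_blocks_two
    (A : EuclideanSpace ℝ (Fin 3) ≃ₗᵢ[ℝ] EuclideanSpace ℝ (Fin 3)) (t : EuclideanSpace ℝ (Fin 3))
    (q y : EuclideanSpace ℝ (Fin 3))
    (hq : q ∈ (fun p => A p + t) '' fccStacking 1 (Real.sqrt (2 / 3)))
    (hy : y ∉ (fun p => A p + t) '' fccStacking 1 (Real.sqrt (2 / 3))) (hqy : dist q y = 1) :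
    ∃ z₁ ∈ (fun p => A p + t) '' fccStacking 1 (Real.sqrt (2 / 3)),
      ∃ z₂ ∈ (fun p => A p + t) '' fccStacking 1 (Real.sqrt (2 / 3)),
        z₁ ≠ z₂ ∧ dist q z₁ = 1 ∧ dist q z₂ = 1 ∧ dist y z₁ < 1 ∧ dist y z₂ < 1 := by
  -- a first slot site of `q`: `q + A u`, `u = (0,1,0)` a unit site
  have hu : barlowPos 1 (Real.sqrt (2 / 3)) constHagg 0 1 0 ∈ fccStacking 1 (Real.sqrt (2 / 3)) :=
    barlowPos_mem _ _ _
  have hun : ‖barlowPos 1 (Real.sqrt (2 / 3)) constHagg 0 1 0‖ = 1 :=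
    norm_barlowPos_fcc_eq_one (by norm_num)
  set z₀ := q + A (barlowPos 1 (Real.sqrt (2 / 3)) constHagg 0 1 0) with hz₀
  have hz₀Λ : z₀ ∈ (fun p => A p + t) '' fccStacking 1 (Real.sqrt (2 / 3)) :=
    movedFcc_add_site_mem A t hq hu
  have hqz₀ : dist q z₀ = 1 := by
    rw [hz₀, dist_eq_norm, sub_add_cancel_left, norm_neg, LinearIsometryEquiv.norm_map, hun]
  -- some blocked slot `z₁ ≠ z₀`… or rather: some blocked slot other than any given one
  have hblocked : ∀ w ∈ (fun p => A p + t) '' fccStacking 1 (Real.sqrt (2 / 3)), dist q w = 1 →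
      ∃ z ∈ (fun p => A p + t) '' fccStacking 1 (Real.sqrt (2 / 3)), dist q z = 1 ∧ z ≠ w ∧
        dist y z < 1 := by
    intro w hw hqw
    by_contra hcon
    push Not at hcon
    have := fcc_single_vacancy_moved A t q y w hq hw hqw hqy (fun z hz hqz hzw => hcon z hz hqz hzw)
    exact hy (this ▸ hw)
  obtain ⟨z₁, hz₁, hqz₁, -, hyz₁⟩ := hblocked z₀ hz₀Λ hqz₀
  obtain ⟨z₂, hz₂, hqz₂, hne, hyz₂⟩ := hblocked z₁ hz₁ hqz₁
  exact ⟨z₁, hz₁, z₂, hz₂, hne.symm, hqz₁, hqz₂, hyz₁, hyz₂⟩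

/-- **Double-vacancy lemma for a moved lattice `A·Λ₀ + t`.** -/
theorem fcc_double_vacancy_moved
    (A : EuclideanSpace ℝ (Fin 3) ≃ₗᵢ[ℝ] EuclideanSpace ℝ (Fin 3)) (t : EuclideanSpace ℝ (Fin 3))
    (q y y' z₁ z₂ : EuclideanSpace ℝ (Fin 3))
    (hq : q ∈ (fun p => A p + t) '' fccStacking 1 (Real.sqrt (2 / 3)))
    (hz₁ : z₁ ∈ (fun p => A p + t) '' fccStacking 1 (Real.sqrt (2 / 3)))
    (hz₂ : z₂ ∈ (fun p => A p + t) '' fccStacking 1 (Real.sqrt (2 / 3)))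
    (hqz₁ : dist q z₁ = 1) (hqz₂ : dist q z₂ = 1) (hne : z₁ ≠ z₂)
    (hy : dist q y = 1) (hy' : dist q y' = 1) (hyy' : 1 ≤ dist y y')
    (h : ∀ z ∈ (fun p => A p + t) '' fccStacking 1 (Real.sqrt (2 / 3)), dist q z = 1 → z ≠ z₁ →
      z ≠ z₂ → 1 ≤ dist y z ∧ 1 ≤ dist y' z) :
    (y = z₁ ∧ y' = z₂) ∨ (y = z₂ ∧ y' = z₁) := by
  set f : EuclideanSpace ℝ (Fin 3) → EuclideanSpace ℝ (Fin 3) := fun s => A.symm (s - t) with hf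
  have hfd : ∀ u w, dist (f u) (f w) = dist u w := by
    intro u w; simp only [hf]; rw [LinearIsometryEquiv.dist_map, dist_sub_right]
  have hfmem : ∀ u, u ∈ (fun p => A p + t) '' fccStacking 1 (Real.sqrt (2 / 3)) →
      f u ∈ fccStacking 1 (Real.sqrt (2 / 3)) := by
    rintro u ⟨p, hp, rfl⟩
    have : f (A p + t) = p := by simp [hf]
    rw [this]; exact hp
  have hfinv : ∀ p, f (A p + t) = p := fun p => by simp [hf]
  have hinj : Function.Injective f := by
    intro u w huw
    have : u - t = w - t := A.symm.injective huw
    simpa using this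
  have key := fcc_double_vacancy (f q) (f y) (f y') (f z₁) (f z₂) (hfmem q hq) (hfmem z₁ hz₁)
    (hfmem z₂ hz₂) (by rw [hfd]; exact hqz₁) (by rw [hfd]; exact hqz₂)
    (fun e => hne (hinj e)) (by rw [hfd]; exact hy) (by rw [hfd]; exact hy')
    (by rw [hfd]; exact hyy') (by
      intro z hz hqz hzz₁ hzz₂
      have hz' : A z + t ∈ (fun p => A p + t) '' fccStacking 1 (Real.sqrt (2 / 3)) := ⟨z, hz, rfl⟩
      have h1 := h (A z + t) hz' (by rw [← hfd, hfinv]; exact hqz)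
        (by intro hc; apply hzz₁; rw [← hfinv z, hc]) (by intro hc; apply hzz₂; rw [← hfinv z, hc])
      rw [← hfd, ← hfd y', hfinv] at h1
      exact h1)
  rcases key with ⟨e1, e2⟩ | ⟨e1, e2⟩
  · exact Or.inl ⟨hinj e1, hinj e2⟩
  · exact Or.inr ⟨hinj e1, hinj e2⟩

/-- **Two contacts, one of them foreign, block at least three slots.**  `q ∈ A·Λ₀ + t`;
`y ∉ A·Λ₀ + t` and `y'` touch `q` and do not overlap (`dist y y' ≥ 1`).  Then three pairwise
distinct nearest-neighbour sites of `q` lie each within distance `< 1` of `y` or of `y'`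
(if `y'` is itself a slot site it counts: `dist y' y' = 0 < 1`). -/
theorem fcc_two_foreign_block_three
    (A : EuclideanSpace ℝ (Fin 3) ≃ₗᵢ[ℝ] EuclideanSpace ℝ (Fin 3)) (t : EuclideanSpace ℝ (Fin 3))
    (q y y' : EuclideanSpace ℝ (Fin 3))
    (hq : q ∈ (fun p => A p + t) '' fccStacking 1 (Real.sqrt (2 / 3)))
    (hy : y ∉ (fun p => A p + t) '' fccStacking 1 (Real.sqrt (2 / 3)))
    (hqy : dist q y = 1) (hqy' : dist q y' = 1) (hyy' : 1 ≤ dist y y') :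
    ∃ z₁ ∈ (fun p => A p + t) '' fccStacking 1 (Real.sqrt (2 / 3)),
      ∃ z₂ ∈ (fun p => A p + t) '' fccStacking 1 (Real.sqrt (2 / 3)),
        ∃ z₃ ∈ (fun p => A p + t) '' fccStacking 1 (Real.sqrt (2 / 3)),
          z₁ ≠ z₂ ∧ z₁ ≠ z₃ ∧ z₂ ≠ z₃ ∧ dist q z₁ = 1 ∧ dist q z₂ = 1 ∧ dist q z₃ = 1 ∧
          (dist y z₁ < 1 ∨ dist y' z₁ < 1) ∧ (dist y z₂ < 1 ∨ dist y' z₂ < 1) ∧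
          (dist y z₃ < 1 ∨ dist y' z₃ < 1) := by
  obtain ⟨z₁, hz₁, z₂, hz₂, hne, hqz₁, hqz₂, hyz₁, hyz₂⟩ := fcc_foreign_blocks_two A t q y hq hy hqy
  by_cases hthird : ∃ z ∈ (fun p => A p + t) '' fccStacking 1 (Real.sqrt (2 / 3)), dist q z = 1 ∧
      z ≠ z₁ ∧ z ≠ z₂ ∧ (dist y z < 1 ∨ dist y' z < 1)
  · obtain ⟨z₃, hz₃, hqz₃, h31, h32, hb⟩ := hthird
    exact ⟨z₁, hz₁, z₂, hz₂, z₃, hz₃, hne, h31.symm, h32.symm, hqz₁, hqz₂, hqz₃, Or.inl hyz₁,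
      Or.inl hyz₂, hb⟩
  · exfalso
    push Not at hthird
    have key := fcc_double_vacancy_moved A t q y y' z₁ z₂ hq hz₁ hz₂ hqz₁ hqz₂ hne hqy hqy' hyy'
      (fun z hz hqz h1 h2 => hthird z hz hqz h1 h2)
    rcases key with ⟨e, -⟩ | ⟨e, -⟩
    · exact hy (e ▸ hz₁)
    · exact hy (e ▸ hz₂)

end Summit.Ventures.Crystal3D.Theorems

end
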